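import Literature.AlgebraicGeometry.Motives.AbelianVarietyTranslationInvariantAmple
import Literature.AlgebraicGeometry.Motives.SemicontinuityGrothendieckComplexProofs
import Literature.AlgebraicGeometry.Motives.SeesawGrauertCubeFactsHoldsProofs
import Literature.AlgebraicGeometry.Motives.AbelianVarietyQuotientAction
import Literature.AlgebraicGeometry.Motives.AbelianVarietyWeilPairingBaseChange
import HarnessLib

/-!
# A translation-invariant divisor class has trivial Mumford divisor, and stays translation-invariant after any field extension
# ([MumfordAV1970] §8 (iv) ⇒ (i); §6 Application 1, proof)

Layer `Literature/AlgebraicGeometry/Motives`, namespace `Literature.AlgebraicGeometry.Motives.AbelianVariety`.  THEOREMS ONLY (no definition,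
no named fact, no instance, no notation, no `sorry`).

For an abelian variety `B` over an ALGEBRAICALLY CLOSED field `K` and a Cartier divisor `D` on `B` whose class is invariant under all translations by
rational points, `t_P^*D ∼ D` for all `P ∈ B(K)` (`[D] ∈ Pic⁰(B)`, [MumfordAV1970] §8 (i)):
* §1 **`mumfordDiv_linEquiv_zero_of_forall_translation_linEquiv`** — Mumford՚s divisor `Λ(D) = m^*D − p₁^*D − p₂^*D` on `B × B` is trivial,
  `Λ(D) ∼ 0` ([MumfordAV1970] §8 (iv)): every `K`-point of `B` lies in the trivial locus `Z(Λ(D))` of `Λ(D)` over `p₂` (the slice at `P` is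
  `t_P^*D − D ∼ 0`), closed points are `K`-points and dense, the trivial locus is closed (seesaw ★ `seesaw_isClosed_trivialLocus_holds`), so it is
  everything, and `Λ(D) ∼ p₂^*M₀` with `M₀ ∼ Λ(D)|_{e × B} ∼ 0` (★ `seesaw_exists_linEquiv_classPullback_holds`) — steps (i)–(iii) of ★
  `dim_eq_zero_of_isAmple_of_forall_linEquiv` WITHOUT the ampleness, recorded as a theorem.
* §2 **`classPullback_translation_linEquiv_baseChange_of_isAlgClosed`** — for ANY field extension `L ⊇ K` the class of `D_L = pr₁^*D` on
  `B_L = B ⊗_K L` is again invariant under translation by EVERY `L`-rational point `y ∈ B_L(L)` (not only those coming from `B(K)`):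
  `t_y^*D_L − D_L ∼ (pr₁, ȳ)^*Λ(D) ∼ 0`, reading the translation of `B_L` through `Hom_L(B_L, B_L) ≃ Hom_K(B_L, B)` (★ `transl_fst`:
  `t_y ≫ pr₁ = (ȳ ∘ pr₂) · pr₁`) and §1 (★ `classPullback_mumfordDiv_linEquiv`); also in the `pullback` spelling
  (`pullback_translation_linEquiv_baseChange_of_isAlgClosed`).  In `K(·)`-language: `K(D) = B ⇒ K(D_L) = B_L`.

Purpose (cell `hodgecm-mathlib`, FLOOR 0 ∕ P1, F-3 (M) book, (Mc) input (H0) «`φ_Θ` is onto `Pic⁰` on geometric points» by TRANSPORT from `ℂ`,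
census `B-provers/B-p09/g17/CENSUS-F3Mc-H0-transport.B-p09g17.md`, file 2 of 5): moving the hypothesis `[D] ∈ Pic⁰` of [MumfordAV1970] §8
Theorem 1 from a countable algebraically closed field `K₂` up to `ℂ` along `σ : K₂ ↪ ℂ`.  HC_CM is proved only modulo the 7 printed citations
until rung 0 closes; nothing here bears on a summit statement.

## References
* [MumfordAV1970] D. Mumford, *Abelian Varieties* (1970), §6 Application 1 (proof, p. 60), §8 (i)–(iv) (the definition of `Pic⁰`, pp. 74–75).
* [GortzWedhorn2023] U. Görtz, T. Wedhorn, *Algebraic Geometry II* (2023), Thm. 24.66 (p. 405; proof pp. 407–408) (seesaw), Def. 27.1 (pp. 604–605) (translations).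
-/

open CategoryTheory CategoryTheory.Limits AlgebraicGeometry MonoidalCategory CartesianMonoidalCategory
open TopologicalSpace Topology

noncomputable section

namespace Literature.AlgebraicGeometry.Motives

open scoped MonObj
open Scheme.IdealSheafData

namespace AbelianVariety

universe u

variable {K : Type u} [Field K]

/-! ## §1 `Λ(D) ∼ 0` for a translation-invariant class over an algebraically closed field -/

section AlgClosed

variable [IsAlgClosed K] (B : AbelianVariety K)

/-- **A translation-invariant divisor class has trivial Mumford divisor** ([MumfordAV1970] §8 (iv)): if `t_P^*D ∼ D` for all `P ∈ B(K)`,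
`K` algebraically closed, then `Λ(D) = m^*D − p₁^*D − p₂^*D ∼ 0` on `B × B`.  Every `K`-point of `B` lies in the trivial locus of `Λ(D)`
over `p₂` (slice `t_P^*D − D`), which is closed (★ seesaw) and so is all of `B` (closed points are dense), whence `Λ(D) ∼ p₂^*M₀` with
`M₀ ∼ Λ(D)|_{e × B} ∼ 0` — the first half of the proof of ★ `dim_eq_zero_of_isAmple_of_forall_linEquiv`, no ampleness needed.
[cite: MumfordAV1970, §8 (iv) (p. 75) and §6 Application 1 (proof, p. 60)] [cite: GortzWedhorn2023, Thm. 24.66 (p. 405; proof pp. 407–408)] -/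
theorem mumfordDiv_linEquiv_zero_of_forall_translation_linEquiv {D : CartierDivisor B.X.left}
    (hinv : ∀ P : B.Points K, (D.classPullback (B.translation P).left).LinEquiv D) :
    (mumfordDiv B D).LinEquiv 0 := by
  set Λ := mumfordDiv B D with hΛ
  -- (i) every `K`-point lies in the trivial locus
  have hpt : ∀ (t₀ : 𝟙_ (SchemeOver K) ⟶ B.X) (s : (𝟙_ (SchemeOver K)).left),
      (D.classPullback ((𝟙 B.X) * (CartesianMonoidalCategory.toUnit _ ≫ t₀)).left).LinEquiv D →
      t₀.left s ∈ CartierDivisor.trivialLocus B.X B.X Λ := fun t₀ s hinv0 => by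
    rw [CartierDivisor.mem_trivialLocus_iff, residuePtι_apply_eq]
    -- the fibre factors through the slice `x ↦ (x, t₀)`
    have e : B.X ◁ (CartesianMonoidalCategory.toUnit (residuePt B.X (t₀.left s)) ≫ t₀) =
        CartesianMonoidalCategory.fst B.X (residuePt B.X (t₀.left s)) ≫ (ρ_ B.X).inv ≫ B.X ◁ t₀ := by
      ext <;> simp
    rw [e, Over.comp_left]
    refine (Λ.classPullback_comp_linEquiv _ _).trans (CartierDivisor.LinEquiv.classPullback_zero _ ?_)
    refine classPullback_mumfordDiv_linEquiv_zero D _ (E₁ := D) (E₂ := 0) ?_ ?_ ?_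
    · have e1 : ((ρ_ B.X).inv ≫ B.X ◁ t₀) ≫ CartesianMonoidalCategory.fst _ _ = 𝟙 _ := by simp
      rw [e1, Over.id_left]; exact D.classPullback_id_linEquiv
    · have e2 : ((ρ_ B.X).inv ≫ B.X ◁ t₀) ≫ CartesianMonoidalCategory.snd _ _ =
          CartesianMonoidalCategory.toUnit _ ≫ t₀ := by simp
      rw [e2]
      exact CartierDivisor.classPullback_linEquiv_zero_of_const _ (fun a a' => by
        have hs : (CartesianMonoidalCategory.toUnit B.X).left a =
            (CartesianMonoidalCategory.toUnit B.X).left a' :=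
          Subsingleton.elim (α := ↥(Spec (CommRingCat.of K))) _ _
        rw [Over.comp_left, Scheme.Hom.comp_apply, Scheme.Hom.comp_apply, hs]) D
    · have e1 : ((ρ_ B.X).inv ≫ B.X ◁ t₀) ≫ CartesianMonoidalCategory.fst _ _ = 𝟙 _ := by simp
      have e2 : ((ρ_ B.X).inv ≫ B.X ◁ t₀) ≫ CartesianMonoidalCategory.snd _ _ =
          CartesianMonoidalCategory.toUnit _ ≫ t₀ := by simp
      rw [e1, e2]
      exact hinv0.trans (D.add_zero_sameDivisor).linEquiv.symm
  -- (ii) hence every point does (closed points are `K`-points and dense)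
  have hZ : IsClosed (CartierDivisor.trivialLocus B.X B.X Λ) := seesaw_isClosed_trivialLocus_holds K B.X B.X Λ
  haveI : JacobsonSpace B.X.left := LocallyOfFiniteType.jacobsonSpace B.X.hom
  have hall : ∀ t : B.X.left, t ∈ CartierDivisor.trivialLocus B.X B.X Λ := by
    have hcl : closedPoints B.X.left ⊆ CartierDivisor.trivialLocus B.X B.X Λ := fun x hx => by
      let t₀ : 𝟙_ (SchemeOver K) ⟶ B.X := Over.homMk (pointOfClosedPoint B.X.hom x hx)
        (by simp)
      have ht₀ : t₀.left (IsLocalRing.closedPoint K) = x := pointOfClosedPoint_apply B.X.hom x hx _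
      -- the translation by the rational point `x` in the two forms
      have e0 : CartesianMonoidalCategory.toUnit B.X ≫ t₀ = toSpecOver B.X ≫ B.pointOfClosed x hx := by
        ext1
        rw [Over.comp_left, Over.comp_left, Over.toUnit_left, toSpecOver_left]
        rfl
      have e : (𝟙 B.X) * (CartesianMonoidalCategory.toUnit _ ≫ t₀) =
          B.translation (B.pointOfClosed x hx) := by
        unfold translation
        rw [mul_comm, e0]
      rw [← ht₀]
      refine hpt t₀ _ ?_
      rw [e]
      exact hinv _
    intro t
    have ht : t ∈ closure (closedPoints B.X.left) := by rw [closure_closedPoints]; trivial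
    exact closure_minimal hcl hZ ht
  -- (iii) seesaw: `Λ ∼ p₂^* M₀`, and `M₀ ∼ Λ|_{e × B} ∼ 0`
  obtain ⟨M₀, hM₀⟩ := seesaw_exists_linEquiv_classPullback_holds K B.X B.X Λ hall
  have hτ : (Λ.classPullback ((λ_ B.X).inv ≫ η[B.X] ▷ B.X).left).LinEquiv 0 := by
    refine classPullback_mumfordDiv_linEquiv_zero D _ (E₁ := 0) (E₂ := D) ?_ ?_ ?_
    · have e1 : ((λ_ B.X).inv ≫ η[B.X] ▷ B.X) ≫ CartesianMonoidalCategory.fst _ _ = 1 := by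
        rw [Hom.one_def]; simp
      rw [e1]; exact classPullback_one_linEquiv_zero D
    · have e2 : ((λ_ B.X).inv ≫ η[B.X] ▷ B.X) ≫ CartesianMonoidalCategory.snd _ _ = 𝟙 _ := by simp
      rw [e2, Over.id_left]; exact D.classPullback_id_linEquiv
    · have e1 : ((λ_ B.X).inv ≫ η[B.X] ▷ B.X) ≫ CartesianMonoidalCategory.fst _ _ = 1 := by
        rw [Hom.one_def]; simp
      have e2 : ((λ_ B.X).inv ≫ η[B.X] ▷ B.X) ≫ CartesianMonoidalCategory.snd _ _ = 𝟙 _ := by simp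
      rw [e1, e2, one_mul, Over.id_left]
      exact D.classPullback_id_linEquiv.trans (D.zero_add_sameDivisor).linEquiv.symm
  have hM₀0 : M₀.LinEquiv 0 := by
    have e : ((λ_ B.X).inv ≫ η[B.X] ▷ B.X) ≫ CartesianMonoidalCategory.snd B.X B.X = 𝟙 _ := by simp
    have h := M₀.classPullback_comp_linEquiv (CartesianMonoidalCategory.snd B.X B.X).left
      ((λ_ B.X).inv ≫ η[B.X] ▷ B.X).left
    rw [← Over.comp_left, e, Over.id_left] at h
    exact (M₀.classPullback_id_linEquiv.symm.trans h).trans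
      (((hM₀.classPullback _).symm).trans hτ)
  have hΛ0 : Λ.LinEquiv 0 := hM₀.trans (hM₀0.classPullback_zero _)
  exact hΛ0

end AlgClosed

/-! ## §2 Base change: translation-invariance on `B(K)`, `K` algebraically closed, survives every field extension -/

section BaseChange

variable [IsAlgClosed K] (L : Type u) [Field L] [Algebra K L] (B : AbelianVariety K)

/-- **Translation-invariance of a divisor class survives base change to ANY extension field, at EVERY rational point** ([MumfordAV1970]
§8 (iv) ⇒ (i), read after base change): for `K` algebraically closed, `t_P^*D ∼ D` for all `P ∈ B(K)`, an extension `L ⊇ K` with projection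
`pr₁ : B_L → B` and ANY `y ∈ B_L(L)`: `t_y^*(pr₁^*D) ∼ pr₁^*D` (class pull-backs).  Indeed `t_y ≫ pr₁ = (ȳ ∘ pr₂) · pr₁` in `Hom_K(B_L, B)`
(★ `transl_fst`), so `t_y^*pr₁^*D − pr₁^*D − (ȳ ∘ pr₂)^*D` is the class of `Λ(D) ∼ 0` (§1) along `(pr₁, ȳ ∘ pr₂) : B_L → B × B`, and
`(ȳ ∘ pr₂)^*D ∼ 0` because `ȳ ∘ pr₂` factors through the point `Spec L`.
[cite: MumfordAV1970, §8 (i)–(iv) (pp. 74–75)] [cite: GortzWedhorn2023, Def. 27.1 (pp. 604–605)] -/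
theorem classPullback_translation_linEquiv_baseChange_of_isAlgClosed {D : CartierDivisor B.X.left}
    (hinv : ∀ P : B.Points K, (D.classPullback (B.translation P).left).LinEquiv D)
    (y : (B.baseChange L).Points L) :
    ((D.classPullback (pullback.fst B.X.hom (bcSpec K L))).classPullback
        ((B.baseChange L).translation y).left).LinEquiv
      (D.classPullback (pullback.fst B.X.hom (bcSpec K L))) := by
  haveI : IsIntegral (B.bcOverK L).left := inferInstanceAs (IsIntegral (B.baseChange L).X.left)
  obtain ⟨s, rfl⟩ := (B.pointsMulEquiv L).surjective y
  -- `t_y ≫ pr₁ = (ȳ ∘ pr₂) · pr₁`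
  have ht : ((B.baseChange L).translation (B.pointsMulEquiv L s)).left ≫ pullback.fst B.X.hom (bcSpec K L) =
      (B.constPt L s * B.fstPt L).left := B.transl_fst L s
  -- the `K`-morphism `φ = (pr₁, ȳ ∘ pr₂) : B_L → B × B`
  set φ : B.bcOverK L ⟶ B.X ⊗ B.X := CartesianMonoidalCategory.lift (B.fstPt L) (B.constPt L s) with hφ
  have e1 : φ ≫ CartesianMonoidalCategory.fst _ _ = B.fstPt L := CartesianMonoidalCategory.lift_fst _ _
  have e2 : φ ≫ CartesianMonoidalCategory.snd _ _ = B.constPt L s := CartesianMonoidalCategory.lift_snd _ _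
  -- `Λ(D) ∼ 0` along `φ`: `(pr₁ · (ȳ ∘ pr₂))^*D ∼ pr₁^*D + (ȳ ∘ pr₂)^*D`
  have hΛ : ((mumfordDiv B D).classPullback φ.left).LinEquiv 0 :=
    (B.mumfordDiv_linEquiv_zero_of_forall_translation_linEquiv hinv).classPullback_zero φ.left
  have h := (classPullback_mumfordDiv_linEquiv D φ).symm.trans hΛ
  rw [e1, e2] at h
  -- `(ȳ ∘ pr₂)^*D ∼ 0`: the map factors through the point `Spec L`
  have hc : (D.classPullback (B.constPt L s).left).LinEquiv 0 :=
    CartierDivisor.classPullback_linEquiv_zero_of_const _ (fun a a' => by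
      have hs : pullback.snd B.X.hom (bcSpec K L) a = pullback.snd B.X.hom (bcSpec K L) a' :=
        Subsingleton.elim (α := ↥(Spec (CommRingCat.of L))) _ _
      change s.left (pullback.snd B.X.hom (bcSpec K L) a) = s.left (pullback.snd B.X.hom (bcSpec K L) a')
      rw [hs]) D
  -- hence `(pr₁ · (ȳ ∘ pr₂))^*D ∼ pr₁^*D`: from `X + (−A + −C) ∼ 0` and `C ∼ 0`
  have hnC : (-(D.classPullback (B.constPt L s).left)).LinEquiv 0 :=
    hc.neg.trans (((CartierDivisor.zero_add_sameDivisor (-(0 : CartierDivisor (B.bcOverK L).left))).linEquiv.symm).trans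
      (CartierDivisor.add_neg_sameDivisor (0 : CartierDivisor (B.bcOverK L).left)).linEquiv)
  have hXA : (D.classPullback (B.fstPt L * B.constPt L s).left + -(D.classPullback (B.fstPt L).left)).LinEquiv 0 :=
    (((CartierDivisor.add_zero_sameDivisor _).linEquiv.symm.trans ((CartierDivisor.LinEquiv.refl _).add hnC.symm)).trans
      (CartierDivisor.add_assoc_sameDivisor _ _ _).linEquiv).trans h
  have hmul : (D.classPullback (B.constPt L s * B.fstPt L).left).LinEquiv (D.classPullback (B.fstPt L).left) := by
    rw [mul_comm]
    exact CartierDivisor.LinEquiv.of_add_neg hXA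
  -- read back on `B_L`: `t_y^*(pr₁^*D) ∼ (t_y ≫ pr₁)^*D = ((ȳ ∘ pr₂) · pr₁)^*D ∼ pr₁^*D`
  have hcomp := D.classPullback_comp_linEquiv (pullback.fst B.X.hom (bcSpec K L))
    ((B.baseChange L).translation (B.pointsMulEquiv L s)).left
  have e := CartierDivisor.classPullback_congr ht D
  exact (e ▸ hcomp.symm).trans hmul

/-- The same in the `pullback` spelling of ★ `exists_linEquiv_weilDiv_of_forall_translate_linEquiv` (translations and `pr₁` are dominant,
★ `classPullback_linEquiv_pullback`): `t_P^*D ∼ D` for all `P ∈ B(K)` (`K` algebraically closed) ⇒ `t_y^*(pr₁^*D) ∼ pr₁^*D` for all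
`y ∈ B_L(L)`. [cite: MumfordAV1970, §8 (i)–(iv) (pp. 74–75)] -/
theorem pullback_translation_linEquiv_baseChange_of_isAlgClosed {D : CartierDivisor B.X.left}
    (hinv : ∀ P : B.Points K, (D.pullback (B.translation P).left).LinEquiv D)
    (π : (B.baseChange L).X.left ⟶ B.X.left) (hπ : π = pullback.fst B.X.hom (bcSpec K L)) [IsDominant π]
    (y : (B.baseChange L).Points L) :
    ((D.pullback π).pullback ((B.baseChange L).translation y).left).LinEquiv (D.pullback π) := by
  subst hπ
  have hinv' : ∀ P : B.Points K, (D.classPullback (B.translation P).left).LinEquiv D := fun P =>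
    (D.classPullback_linEquiv_pullback (B.translation P).left).trans (hinv P)
  have h := B.classPullback_translation_linEquiv_baseChange_of_isAlgClosed L hinv' y
  -- move between `classPullback` and `pullback`
  have e₁ := D.classPullback_linEquiv_pullback (pullback.fst B.X.hom (bcSpec K L))
  have e₂ := (D.pullback (pullback.fst B.X.hom (bcSpec K L))).classPullback_linEquiv_pullback
    ((B.baseChange L).translation y).left
  exact (e₂.symm.trans ((e₁.symm.classPullback _).trans (h.trans e₁)))

end BaseChange

end AbelianVariety

end Literature.AlgebraicGeometry.Motives

end
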